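import Mathlib
import HarnessLib
import Summits.HubbardSuperconductivity.HubbardSuperconductivity.Theorems.KLProgrammeC4aCausticAngleLayer

/-!
# Route `KLProgramme` — crux C4a, S3 brick (B4) «(B4)-UMK1», (N2) the PRE-CAUSTIC FIRST-ORDER LAW along ONE LEVEL LINE: the first-order jet integrand
# `w(e)·X(e)·∂_uK(e, ē(e))` on a pre-caustic loop angle is the ANTI-DIAGONAL FLATNESS NUMBER of the weighted kernel plus deformation terms — the kernel
# hypothesis that envelope bounds cannot replace

Cell `gate-hubbard-kl`, seat hubbard-kl-k3c3-p3 (g28; row «implicit-function / monotonicity route for μ(n)»).  Located brick for the (C)-closer lane hubbard-kl-c4a-1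
(stub (C) `stub_twoLeg_curvature` of `KLRegimeEngineV17F2`, stmt-HubbardSuperconductivity-20437), memo HOME/hubbard-kl-k3c3-p3/U1-CAUSTIC-SUP.md §0/§3/§4 (N2).

WHY.  Across an umklapp caustic the co-moving bubble has a ONE-SIDED square-root cusp; on the PRE-caustic side the first-order jet is `≍ lo·max(δ₀,lo)^{−3/2}` (small), by an
INTER-LEVEL cancellation: at a loop angle `v` the partner level along the level direction is `ē(e) = D − e + r(e)` (`|r′| = |∂_eē + 1| ≤ η`, p658951), the weighted kernel's
anti-diagonal level integral `D ↦ ∫de w(e)K(e, D − e)` is nearly constant (`∫₀^D de/(e + (D − e)) = 1` for the T = 0 pp kernel; `= 1 − 2lo/D` with sharp symmetric level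
cutoffs; with the finer-line split `= ½ − lo/D`), and the jet is its `D`-derivative up to deformation terms.  Envelope hypotheses `|∂_uK| ≤ 1/max(t,|u|)²` see each level with
the same sign (`≍ 1/D²` per level, `≍ 1/D` after the level integral) and give the two-sided `|δ₀|^{−1/2}` of `…C4aFoldLevelLayer`, which is not θ-uniform at an antipodal-umklapp
touch (memo §3).  This file isolates the ONE number the kernel must supply:
* **`abs_intervalIntegral_deformed_antidiagonal_le`**: on a level line `[a,b] ∋ e₀` with weight `0 ≤ w ≤ W`, smooth factor `|X| ≤ X₀`, `|X(e) − X(e₀)| ≤ X₁|e − e₀|`, deformation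
  `|r(e)| ≤ η|e − e₀|` (`η(b−a) ≤ ρ₀`), local kernel data `|∂_uK(e, D−e)| ≤ B₁`, `|∂_uK(e,u) − ∂_uK(e,D−e)| ≤ B₂|u − (D−e)|` for `|u − (D−e)| ≤ ρ₀` (`X₁, B₂ ≥ 0`), and the
  ANTI-DIAGONAL FLATNESS NUMBER `|∫_a^b w(e)·∂_uK(e, D − e) de| ≤ A_fl`:
  `|∫_a^b w·X·∂_uK(e, D − e + r(e)) de| ≤ X₀·A_fl + W·(X₀B₂η + X₁B₁)·(b − a)²`.
  In the split currency (`[a,b] ⊂ [lo, D/2]`, `B₁ = 16/D²`, `B₂ = 128/D³`, `b − a ≤ D/2`): `≤ X₀·A_fl + W·(32X₀η/D + 4X₁)`; with `A_fl = A·lo/max(D,lo)²` (model B: `A = 2W`,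
  exact) and `η ≤ η₁D + η₂|v − v*|` this is the per-angle input of the loop-angle layer, whose output `A′·lo·max(δ₀,lo)^{−3/2} + B′(1 + log)` is the pre-side hypothesis of
  `…C4aCausticPairLayer.intervalIntegral_caustic_pair_le`.  WHAT THE CLOSER MUST VERIFY ONCE for the model's kernel ((B3) representation): the flatness number — an explicit
  computation with the cutoff functions, not an envelope.
Pure real analysis (Lipschitz bookkeeping); nothing about the model; nothing asserts (C), K3 or superconductivity.
References: FST II CPAM 51 (1998) §3 [cite: FeldmanSalmhoferTrubowitz1998]; Salmhofer 1999 §4.5.3 [cite: Salmhofer1999].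
-/

noncomputable section

namespace Summit.HubbardSuperconductivity.HubbardSuperconductivity.Theorems.C4a

set_option linter.dupNamespace false -- summit = problem name (single-conjunct summit), D-0017

open Real Set MeasureTheory intervalIntegral
open scoped Interval

/-- **THE PRE-CAUSTIC FIRST-ORDER LAW ALONG ONE LEVEL LINE (deformed anti-diagonal).**  See the module docstring: the level integral of `w·X·∂_uK(e, D − e + r(e))` is
bounded by `X₀` times the anti-diagonal flatness number `A_fl ≥ |∫ w·∂_uK(e, D−e)|` plus the deformation/variation terms `W·(X₀B₂η + X₁B₁)·(b−a)²`. -/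
theorem abs_intervalIntegral_deformed_antidiagonal_le {Ku : ℝ → ℝ → ℝ} {w X r : ℝ → ℝ} {a b e₀ D W X₀ X₁ η ρ₀ B₁ B₂ Afl : ℝ}
    (hab : a ≤ b) (he₀ : e₀ ∈ Icc a b)
    (hfi : IntervalIntegrable (fun e => w e * X e * Ku e (D - e + r e)) volume a b)
    (hgi : IntervalIntegrable (fun e => w e * Ku e (D - e)) volume a b)
    (hw0 : ∀ e ∈ Icc a b, 0 ≤ w e) (hwW : ∀ e ∈ Icc a b, w e ≤ W)
    (hX0 : ∀ e ∈ Icc a b, |X e| ≤ X₀) (hX1 : ∀ e ∈ Icc a b, |X e - X e₀| ≤ X₁ * |e - e₀|)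
    (hX₁ : 0 ≤ X₁) (hη : 0 ≤ η) (hr : ∀ e ∈ Icc a b, |r e| ≤ η * |e - e₀|) (hηρ : η * (b - a) ≤ ρ₀)
    (hB₁ : ∀ e ∈ Icc a b, |Ku e (D - e)| ≤ B₁) (hB₂0 : 0 ≤ B₂)
    (hB₂ : ∀ e ∈ Icc a b, ∀ u : ℝ, |u - (D - e)| ≤ ρ₀ → |Ku e u - Ku e (D - e)| ≤ B₂ * |u - (D - e)|)
    (hflat : |∫ e in a..b, w e * Ku e (D - e)| ≤ Afl) :
    |∫ e in a..b, w e * X e * Ku e (D - e + r e)| ≤ X₀ * Afl + W * (X₀ * B₂ * η + X₁ * B₁) * (b - a) ^ 2 := by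
  have hX00 : 0 ≤ X₀ := (abs_nonneg _).trans (hX0 e₀ he₀)
  have hW0 : 0 ≤ W := (hw0 e₀ he₀).trans (hwW e₀ he₀)
  have hB₁0 : 0 ≤ B₁ := (abs_nonneg _).trans (hB₁ e₀ he₀)
  -- pointwise bound of the difference to the frozen anti-diagonal integrand
  have hpt : ∀ e ∈ Ι a b, ‖w e * X e * Ku e (D - e + r e) - X e₀ * (w e * Ku e (D - e))‖ ≤ W * (X₀ * B₂ * η + X₁ * B₁) * (b - a) := by
    intro e he
    rw [uIoc_of_le hab] at he
    have heI : e ∈ Icc a b := Ioc_subset_Icc_self he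
    have hee₀ : |e - e₀| ≤ b - a := by
      rw [abs_le]; constructor <;> linarith [heI.1, heI.2, he₀.1, he₀.2]
    have hre : |r e| ≤ ρ₀ := (hr e heI).trans ((mul_le_mul_of_nonneg_left hee₀ hη).trans hηρ)
    have hu : |D - e + r e - (D - e)| ≤ ρ₀ := by rw [show D - e + r e - (D - e) = r e by ring]; exact hre
    have hK2 := hB₂ e heI (D - e + r e) hu
    rw [show D - e + r e - (D - e) = r e by ring] at hK2
    have hsplit : w e * X e * Ku e (D - e + r e) - X e₀ * (w e * Ku e (D - e)) =
        w e * (X e * (Ku e (D - e + r e) - Ku e (D - e)) + (X e - X e₀) * Ku e (D - e)) := by ring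
    rw [hsplit, Real.norm_eq_abs, abs_mul, abs_of_nonneg (hw0 e heI)]
    have h1 : |X e * (Ku e (D - e + r e) - Ku e (D - e))| ≤ X₀ * (B₂ * (η * (b - a))) := by
      rw [abs_mul]
      refine mul_le_mul (hX0 e heI) (hK2.trans ?_) (abs_nonneg _) hX00
      exact mul_le_mul_of_nonneg_left ((hr e heI).trans (mul_le_mul_of_nonneg_left hee₀ hη)) hB₂0
    have h2 : |(X e - X e₀) * Ku e (D - e)| ≤ X₁ * (b - a) * B₁ := by
      rw [abs_mul]
      have hX1' : |X e - X e₀| ≤ X₁ * (b - a) := (hX1 e heI).trans (mul_le_mul_of_nonneg_left hee₀ hX₁)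
      exact mul_le_mul hX1' (hB₁ e heI) (abs_nonneg _) ((abs_nonneg _).trans hX1')
    calc w e * |X e * (Ku e (D - e + r e) - Ku e (D - e)) + (X e - X e₀) * Ku e (D - e)|
        ≤ W * (X₀ * (B₂ * (η * (b - a))) + X₁ * (b - a) * B₁) := by
          refine mul_le_mul (hwW e heI) ((abs_add_le _ _).trans (add_le_add h1 h2)) (abs_nonneg _) hW0
      _ = W * (X₀ * B₂ * η + X₁ * B₁) * (b - a) := by ring
  -- integrate the difference
  have hdiff := intervalIntegral.norm_integral_le_of_norm_le_const hpt
  rw [intervalIntegral.integral_sub hfi (hgi.const_mul (X e₀)), intervalIntegral.integral_const_mul, Real.norm_eq_abs,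
    abs_of_nonneg (sub_nonneg.2 hab)] at hdiff
  -- triangle inequality
  have hmain : |∫ e in a..b, w e * X e * Ku e (D - e + r e)| ≤
      |X e₀ * ∫ e in a..b, w e * Ku e (D - e)| + W * (X₀ * B₂ * η + X₁ * B₁) * (b - a) * (b - a) := by
    have h := abs_sub_abs_le_abs_sub (∫ e in a..b, w e * X e * Ku e (D - e + r e)) (X e₀ * ∫ e in a..b, w e * Ku e (D - e))
    linarith
  refine hmain.trans ?_
  rw [abs_mul, pow_two, ← mul_assoc]
  have h3 : |X e₀| * |∫ e in a..b, w e * Ku e (D - e)| ≤ X₀ * Afl :=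
    mul_le_mul (hX0 e₀ he₀) hflat (abs_nonneg _) hX00
  linarith

end Summit.HubbardSuperconductivity.HubbardSuperconductivity.Theorems.C4a

end
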